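import Literature.Computability.Cryptography.QuantumTuringMachineLocalConditions
import Literature.Computability.Cryptography.QuantumTuringMachinePositioned
import HarnessLib

/-!
# Bernstein–Vazirani's Theorem 5.3 in their own (positioned) model

Sibling file of `QuantumTuringMachineLocalConditions.lean` (BV 1997 Thm. 5.3 for the tree's
head-centred model: `QTM.IsLocallyWellFormed` — unit length, orthogonality, separability —
`⟹ QTM.IsWellFormed` always, `⟸` for `[Nontrivial M.Γ]`) and of
`QuantumTuringMachinePositioned.lean` (Bernstein–Vazirani's positioned configurations
`QTM.PCfg = M.Cfg × ℤ`, their time evolution `QTM.pevolve` and well-formedness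
`QTM.PIsWellFormed`, BV Def. 3.2–3.3; faithfulness to BV's triples `(q, T, ξ)` is
`QuantumTuringMachinePositionedFaithful.lean`).

Main results (all proved, every tape alphabet):

* `QTM.pIsWellFormed_iff_isLocallyWellFormed` — **Bernstein–Vazirani 1997, Thm. 5.3, verbatim**
  (p. 1434): in BV's model a QTM is well formed iff its local transition function satisfies
  unit length, orthogonality and separability; both halves
  `QTM.IsLocallyWellFormed.pIsWellFormed`, `QTM.PIsWellFormed.isLocallyWellFormed`. No
  hypothesis on the alphabet: head positions separate what the head-centred model identifies.
* Combined with `QuantumTuringMachineLocalConditions.lean` this re-proves, through the local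
  conditions, the transport `QTM.pIsWellFormed_iff_isWellFormed` of
  `QuantumTuringMachinePositionedFaithful.lean` (tree well-formedness = BV well-formedness for
  tape alphabets with a non-blank symbol; proved there by a far-away witness cell) — not restated
  here. Over a one-symbol alphabet the tree's notion is strictly weaker
  (`QTM.ModelExamples.halfHalf`), while THIS file's characterisation of `PIsWellFormed` holds for
  every alphabet: it is the local certificate that constructions of BV-well-formed machines
  (Bernstein–Vazirani §4–§5, Nishimura–Ozawa 2002 Lemma 5.1) verify.
* `QTM.pIsWellFormed_iff_pgram` — the Gram form in the positioned model
  (`QTM.sqNorm_pevolve`: `‖U ψ‖² = ∑ ψ(c₁) conj ψ(c₂) G(c₁, c₂)` with `QTM.pgram`).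

## Proof

Word for word the proof of `QuantumTuringMachineLocalConditions.lean` (BV p. 1434: columns of
`U` orthonormal; coincidences of update triples with the same direction need tapes agreeing off
the head AND equal positions, `QTM.pupdTarget_eq_iff_same`; a left-moving update of `c₁` meets a
right-moving update of `c₂` only if the position of `c₂` is two less, and then contributes a
separability product, `QTM.pgramDir_ne`), with the position bookkeeping `ξ ∓ 1`
(`QTM.shiftOfBool`). For necessity the test configurations carry positions instead of marker
symbols: `((p, ⟨σ, ε, ε⟩), 0)` for unit length and orthogonality (`QTM.pgram_ptestCfg`), and the
pair `((p₁, ⟨σ₁, # τ₂, ε⟩), 2)`, `((p₂, ⟨σ₂, ε, # τ₁⟩), 0)` — heads two cells apart, BV's third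
case — for separability (`QTM.pgram_psepCfg`), so no symbol other than the blank `#` is needed.

## References

* E. Bernstein, U. Vazirani, *Quantum complexity theory*, SIAM J. Comput. 26 (1997) 1411–1473
  [BernsteinVazirani1997SICOMP]: Def. 3.2–3.3, Def. 5.2, Thm. 5.3 (p. 1434) and its proof.
* M. Ozawa, H. Nishimura, *Local transition functions of quantum Turing machines*, RAIRO Theor.
  Inform. Appl. 34 (2000) 379–402 [OzawaNishimura1998], Thm. 4.5 (the same characterisation,
  column-vector approach).
-/

noncomputable section

namespace Literature.Computability.Cryptography

namespace QTM

open Turing Finsupp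
open scoped BigOperators ComplexConjugate

variable (M : QTM)

/-- The change `∓1` of the absolute head position coded by the direction bit (`false` = left =
`-1`, `true` = right = `+1`; Bernstein–Vazirani 1997, Def. 3.2). [cite: BernsteinVazirani1997SICOMP, Def. 3.2] -/
def shiftOfBool : Bool → ℤ
  | false => -1
  | true => 1

/-- Moving left decrements the position. [folklore] -/
@[simp] theorem shiftOfBool_false : shiftOfBool false = -1 := rfl
/-- Moving right increments the position. [folklore] -/
@[simp] theorem shiftOfBool_true : shiftOfBool true = 1 := rfl

/-- The positioned configuration reached from `c` by the update triple `u`: the head-relative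
target `QTM.updTarget` together with the new absolute position (Bernstein–Vazirani 1997,
Def. 3.2). [cite: BernsteinVazirani1997SICOMP, Def. 3.2] -/
def pupdTarget (c : M.PCfg) (u : M.Upd) : M.PCfg :=
  (M.updTarget c.1 u, c.2 + shiftOfBool u.1)

/-- One positioned step from a basis state as a sum over update triples,
`U |c⟩ = ∑_u δ(c, u) |ptgt(c, u)⟩` (Bernstein–Vazirani 1997, Def. 3.2). [cite: BernsteinVazirani1997SICOMP, Def. 3.2] -/
theorem pevolve_single_eq_sum (c : M.PCfg) (a : ℂ) :
    M.pevolve (Finsupp.single c a) =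
      ∑ u : M.Upd, (a * M.updAmp c.1 u) • Finsupp.single (M.pupdTarget c u) (1 : ℂ) := by
  unfold pevolve pevolveWith
  rw [Finsupp.sum_single_index (M.pstep_zero _ c)]
  simp only [pstep, Upd, Fintype.sum_prod_type, Fintype.sum_bool, pupdTarget, updTarget, updAmp,
    dirOfBool_true, dirOfBool_false, shiftOfBool_true, shiftOfBool_false, Finset.sum_add_distrib,
    ← sub_eq_add_neg]
  exact add_comm _ _

/-- Linearity of the positioned evolution, `U ψ = ∑_{c ∈ supp ψ} U (ψ c |c⟩)`. [folklore] -/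
theorem pevolve_eq_finsuppSum (ψ : M.PCfg →₀ ℂ) :
    M.pevolve ψ = ψ.sum fun c a => M.pevolve (Finsupp.single c a) := by
  unfold pevolve pevolveWith
  refine Finsupp.sum_congr fun c _ => ?_
  rw [Finsupp.sum_single_index (M.pstep_zero _ c)]

/-- The positioned evolution as one indexed sum of scaled basis states. [folklore] -/
theorem pevolve_eq_sum (ψ : M.PCfg →₀ ℂ) :
    M.pevolve ψ = ∑ i : ↥ψ.support × M.Upd,
      (ψ i.1 * M.updAmp i.1.1.1 i.2) • Finsupp.single (M.pupdTarget i.1 i.2) (1 : ℂ) := by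
  rw [Fintype.sum_prod_type, pevolve_eq_finsuppSum]
  unfold Finsupp.sum
  rw [← Finset.sum_coe_sort]
  exact Finset.sum_congr rfl fun c _ => M.pevolve_single_eq_sum c (ψ c)

open Classical in
/-- **Gram expansion** for the `ℓ²` norm `sqNorm` of `QuantumTuringMachinePrecision.lean` on any
index type: `‖∑ᵢ zᵢ |tᵢ⟩‖² = ∑_{i, j : tᵢ = tⱼ} zᵢ conj zⱼ`. [folklore] -/
theorem sqNorm_finsuppSum {ι α : Type*} [Fintype ι] (t : ι → α) (z : ι → ℂ) :
    ((sqNorm (∑ i, z i • Finsupp.single (t i) (1 : ℂ)) : ℝ) : ℂ) =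
      ∑ i, ∑ j, if t i = t j then z i * conj (z j) else 0 := by
  set φ := ∑ i, z i • Finsupp.single (t i) (1 : ℂ) with hφ
  have hsupp : φ.support ⊆ Finset.image t Finset.univ := support_finsuppSum_subset t z
  rw [sqNorm_eq_sum_of_subset hsupp]
  push_cast
  simp_rw [← Complex.mul_conj', hφ, finsuppSum_apply, map_sum, Finset.sum_mul_sum]
  rw [Finset.sum_comm]
  refine Finset.sum_congr rfl fun i _ => ?_
  rw [Finset.sum_comm]
  refine Finset.sum_congr rfl fun j _ => ?_
  rw [Finset.sum_eq_single (t i)]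
  · rw [if_pos rfl]
    by_cases h : t i = t j
    · rw [if_pos h, ← h, if_pos rfl]
    · rw [if_neg h, if_neg (Ne.symm h), map_zero, mul_zero]
  · intro c _ hc
    rw [if_neg (Ne.symm hc), zero_mul]
  · intro h
    exact absurd (Finset.mem_image_of_mem t (Finset.mem_univ i)) h

open Classical in
/-- **The positioned Gram coefficient** `G(c₁, c₂)`: the inner product of the columns `c₂`, `c₁`
of Bernstein–Vazirani's time evolution matrix (proof of Thm. 5.3). [cite: BernsteinVazirani1997SICOMP, Thm. 5.3 (proof)] -/
def pgram (c₁ c₂ : M.PCfg) : ℂ :=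
  ∑ u₁ : M.Upd, ∑ u₂ : M.Upd,
    if M.pupdTarget c₁ u₁ = M.pupdTarget c₂ u₂ then
      M.updAmp c₁.1 u₁ * conj (M.updAmp c₂.1 u₂) else 0

/-- **`‖U ψ‖²` as a Gram form** in the positioned model. [folklore] -/
theorem sqNorm_pevolve (ψ : M.PCfg →₀ ℂ) :
    ((sqNorm (M.pevolve ψ) : ℝ) : ℂ) =
      ∑ c₁ ∈ ψ.support, ∑ c₂ ∈ ψ.support, ψ c₁ * conj (ψ c₂) * M.pgram c₁ c₂ := by
  classical
  rw [pevolve_eq_sum, sqNorm_finsuppSum, Fintype.sum_prod_type, ← Finset.sum_coe_sort ψ.support]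
  refine Finset.sum_congr rfl fun c₁ _ => ?_
  rw [Finset.sum_comm, Fintype.sum_prod_type, ← Finset.sum_coe_sort ψ.support]
  refine Finset.sum_congr rfl fun c₂ _ => ?_
  rw [pgram, Finset.mul_sum, Finset.sum_comm]
  refine Finset.sum_congr rfl fun u₁ _ => ?_
  rw [Finset.mul_sum]
  refine Finset.sum_congr rfl fun u₂ _ => ?_
  split_ifs
  · simp only [map_mul]; ring
  · rw [mul_zero]

/-- `‖ψ‖² = ∑_{c ∈ supp ψ} ψ(c) conj ψ(c)` for `sqNorm` (cast to `ℂ`). [folklore] -/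
theorem coe_sqNorm_eq_sum {α : Type*} (ψ : α →₀ ℂ) :
    ((sqNorm ψ : ℝ) : ℂ) = ∑ c ∈ ψ.support, ψ c * conj (ψ c) := by
  unfold sqNorm
  push_cast
  simp only [Complex.mul_conj']

open Classical in
/-- Orthonormal columns give BV well-formedness (proof of Thm. 5.3). [cite: BernsteinVazirani1997SICOMP, Thm. 5.3 (proof)] -/
theorem pIsWellFormed_of_pgram
    (h : ∀ c₁ c₂ : M.PCfg, M.pgram c₁ c₂ = if c₁ = c₂ then 1 else 0) : M.PIsWellFormed := by
  intro ψ
  apply Complex.ofReal_injective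
  rw [sqNorm_pevolve, coe_sqNorm_eq_sum]
  refine Finset.sum_congr rfl fun c₁ hc₁ => ?_
  simp_rw [h, mul_ite, mul_one, mul_zero]
  rw [Finset.sum_ite_eq, if_pos hc₁]

/-! ### Which update triples reach the same positioned configuration -/

/-- **Same direction** (BV proof of Thm. 5.3, second case): same new state, same written
symbol, tapes agreeing off the head, AND the same position. [cite: BernsteinVazirani1997SICOMP, Thm. 5.3 (proof)] -/
theorem pupdTarget_eq_iff_same (c₁ c₂ : M.PCfg) (e : Bool) (q₁ q₂ : M.Λ) (b₁ b₂ : M.Γ) :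
    M.pupdTarget c₁ (e, q₁, b₁) = M.pupdTarget c₂ (e, q₂, b₂) ↔
      q₁ = q₂ ∧ b₁ = b₂ ∧ M.SameOffHead c₁.1.tape c₂.1.tape ∧ c₁.2 = c₂.2 := by
  rw [pupdTarget, pupdTarget, Prod.mk.injEq, updTarget_eq_iff_same, add_left_inj]
  tauto

/-- In general: same new state, same resulting head-relative tape and same resulting position. [folklore] -/
theorem pupdTarget_eq_iff (c₁ c₂ : M.PCfg) (e₁ e₂ : Bool) (q₁ q₂ : M.Λ) (b₁ b₂ : M.Γ) :
    M.pupdTarget c₁ (e₁, q₁, b₁) = M.pupdTarget c₂ (e₂, q₂, b₂) ↔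
      q₁ = q₂ ∧ ((c₁.1.tape.write b₁).move (dirOfBool e₁) =
        (c₂.1.tape.write b₂).move (dirOfBool e₂) ∧ c₁.2 + shiftOfBool e₁ = c₂.2 + shiftOfBool e₂) := by
  rw [pupdTarget, pupdTarget, Prod.mk.injEq, updTarget_eq_iff]
  tauto

open Classical in
/-- The part of `G(c₁, c₂)` contributed by a fixed pair of directions. [folklore] -/
def pgramDir (c₁ c₂ : M.PCfg) (e₁ e₂ : Bool) : ℂ :=
  ∑ q₁ : M.Λ, ∑ b₁ : M.Γ, ∑ q₂ : M.Λ, ∑ b₂ : M.Γ,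
    if M.pupdTarget c₁ (e₁, q₁, b₁) = M.pupdTarget c₂ (e₂, q₂, b₂) then
      M.updAmp c₁.1 (e₁, q₁, b₁) * conj (M.updAmp c₂.1 (e₂, q₂, b₂)) else 0

/-- `G(c₁, c₂)` split by the four pairs of directions. [folklore] -/
theorem pgram_eq_sum_pgramDir (c₁ c₂ : M.PCfg) :
    M.pgram c₁ c₂ = M.pgramDir c₁ c₂ false false + M.pgramDir c₁ c₂ false true +
      (M.pgramDir c₁ c₂ true false + M.pgramDir c₁ c₂ true true) := by
  simp only [pgram, pgramDir, Upd, Fintype.sum_prod_type, Fintype.sum_bool, Finset.sum_add_distrib]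
  abel

open Classical in
/-- **Same-direction contributions** (BV proof of Thm. 5.3, second case). [cite: BernsteinVazirani1997SICOMP, Thm. 5.3 (proof)] -/
theorem pgramDir_same (c₁ c₂ : M.PCfg) (e : Bool) :
    M.pgramDir c₁ c₂ e e = if M.SameOffHead c₁.1.tape c₂.1.tape ∧ c₁.2 = c₂.2 then
      ∑ q : M.Λ, ∑ b : M.Γ, M.updAmp c₁.1 (e, q, b) * conj (M.updAmp c₂.1 (e, q, b)) else 0 := by
  unfold pgramDir
  simp_rw [pupdTarget_eq_iff_same, sum_sum_ite_eq_and, sum_ite_eq_and, sum_ite_const]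

open Classical in
/-- **Mixed-direction contributions**: restricted-superposition products over the pairs of
written symbols whose resulting positioned configurations coincide (BV proof of Thm. 5.3,
third case: heads two cells apart). [cite: BernsteinVazirani1997SICOMP, Thm. 5.3 (proof)] -/
theorem pgramDir_ne (c₁ c₂ : M.PCfg) (e₁ e₂ : Bool) :
    M.pgramDir c₁ c₂ e₁ e₂ = ∑ b₁ : M.Γ, ∑ b₂ : M.Γ,
      if (c₁.1.tape.write b₁).move (dirOfBool e₁) = (c₂.1.tape.write b₂).move (dirOfBool e₂) ∧
          c₁.2 + shiftOfBool e₁ = c₂.2 + shiftOfBool e₂ then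
        ∑ q : M.Λ, M.updAmp c₁.1 (e₁, q, b₁) * conj (M.updAmp c₂.1 (e₂, q, b₂)) else 0 := by
  unfold pgramDir
  simp_rw [pupdTarget_eq_iff, sum_sum_ite_eq_and]
  rw [Finset.sum_comm]
  refine Finset.sum_congr rfl fun b₁ _ => ?_
  rw [Finset.sum_comm]
  refine Finset.sum_congr rfl fun b₂ _ => ?_
  rw [sum_ite_const]

variable {M}

/-- Separability kills the (left of `c₁`, right of `c₂`) contributions. [cite: BernsteinVazirani1997SICOMP, Thm. 5.3 (proof)] -/
theorem IsLocallyWellFormed.pgramDir_left_right (h : M.IsLocallyWellFormed) (c₁ c₂ : M.PCfg) :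
    M.pgramDir c₁ c₂ false true = 0 := by
  rw [pgramDir_ne]
  refine Finset.sum_eq_zero fun b₁ _ => Finset.sum_eq_zero fun b₂ _ => ?_
  have := h.separability c₁.1.q c₁.1.tape.head b₁ c₂.1.q c₂.1.tape.head b₂
  unfold restrictedInner at this
  simp only [updAmp, dirOfBool_false, dirOfBool_true, this, ite_self]

/-- Separability (conjugated, roles exchanged) kills the (right of `c₁`, left of `c₂`)
contributions. [cite: BernsteinVazirani1997SICOMP, Thm. 5.3 (proof)] -/
theorem IsLocallyWellFormed.pgramDir_right_left (h : M.IsLocallyWellFormed) (c₁ c₂ : M.PCfg) :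
    M.pgramDir c₁ c₂ true false = 0 := by
  rw [pgramDir_ne]
  refine Finset.sum_eq_zero fun b₁ _ => Finset.sum_eq_zero fun b₂ _ => ?_
  have h0 := h.separability c₂.1.q c₂.1.tape.head b₂ c₁.1.q c₁.1.tape.head b₁
  unfold restrictedInner at h0
  have h1 : ∑ q : M.Λ, M.updAmp c₁.1 (true, q, b₁) * conj (M.updAmp c₂.1 (false, q, b₂)) =
      conj (∑ q : M.Λ, M.δ c₂.1.q c₂.1.tape.head q b₂ Dir.left *
        conj (M.δ c₁.1.q c₁.1.tape.head q b₁ Dir.right)) := by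
    rw [map_sum]
    refine Finset.sum_congr rfl fun q _ => ?_
    simp only [updAmp, dirOfBool_false, dirOfBool_true, map_mul, Complex.conj_conj]
    ring
  simp only [h1, h0, map_zero, ite_self]

variable (M)

/-- Same tape off the head and same position: the same-direction contributions add up to
`δ(p₁, σ₁) · δ(p₂, σ₂)`. [cite: BernsteinVazirani1997SICOMP, Thm. 5.3 (proof)] -/
theorem pgramDir_false_add_true (c₁ c₂ : M.PCfg) (hS : M.SameOffHead c₁.1.tape c₂.1.tape)
    (hξ : c₁.2 = c₂.2) :
    M.pgramDir c₁ c₂ false false + M.pgramDir c₁ c₂ true true =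
      M.updateInner c₁.1.q c₁.1.tape.head c₂.1.q c₂.1.tape.head := by
  classical
  rw [pgramDir_same, pgramDir_same, if_pos ⟨hS, hξ⟩, if_pos ⟨hS, hξ⟩, updateInner,
    ← Finset.sum_add_distrib]
  refine Finset.sum_congr rfl fun q _ => ?_
  rw [← Finset.sum_add_distrib]
  rfl

open Classical in
/-- **The positioned Gram coefficients of a locally well-formed QTM are those of an isometry.** [cite: BernsteinVazirani1997SICOMP, Thm. 5.3 (proof)] -/
theorem IsLocallyWellFormed.pgram_eq {M : QTM} (h : M.IsLocallyWellFormed) (c₁ c₂ : M.PCfg) :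
    M.pgram c₁ c₂ = if c₁ = c₂ then 1 else 0 := by
  rw [pgram_eq_sum_pgramDir, h.pgramDir_left_right, h.pgramDir_right_left, add_zero, zero_add]
  by_cases hS : M.SameOffHead c₁.1.tape c₂.1.tape ∧ c₁.2 = c₂.2
  · rw [M.pgramDir_false_add_true c₁ c₂ hS.1 hS.2]
    by_cases hps : (c₁.1.q, c₁.1.tape.head) = (c₂.1.q, c₂.1.tape.head)
    · obtain ⟨hq, hh⟩ := Prod.mk.injEq _ _ _ _ ▸ hps
      have hc : c₁ = c₂ := by
        obtain ⟨⟨q₁, T₁⟩, ξ₁⟩ := c₁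
        obtain ⟨⟨q₂, T₂⟩, ξ₂⟩ := c₂
        obtain ⟨a₁, L₁, R₁⟩ := T₁
        obtain ⟨a₂, L₂, R₂⟩ := T₂
        simp only [SameOffHead] at hq hh hS
        simp [hq, hh, hS.1.1, hS.1.2, hS.2]
      rw [if_pos hc, ← hq, ← hh, updateInner_self, h.unit_length, Complex.ofReal_one]
    · have hc : c₁ ≠ c₂ := by
        rintro rfl
        exact hps rfl
      rw [if_neg hc, h.orthogonality _ _ _ _ hps]
  · rw [pgramDir_same, pgramDir_same, if_neg hS, if_neg hS, add_zero, if_neg]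
    rintro rfl
    exact hS ⟨⟨rfl, rfl⟩, rfl⟩

/-- **Bernstein–Vazirani 1997, Theorem 5.3, sufficiency (p. 1434), in BV's model**: unit length,
orthogonality and separability imply that the positioned time evolution preserves length. Every
tape alphabet. [cite: BernsteinVazirani1997SICOMP, Thm. 5.3] -/
theorem IsLocallyWellFormed.pIsWellFormed {M : QTM} (h : M.IsLocallyWellFormed) :
    M.PIsWellFormed :=
  M.pIsWellFormed_of_pgram h.pgram_eq

/-! ### Necessity (every alphabet) -/

/-- The positioned Gram form over any finite set containing the support. [folklore] -/
theorem sqNorm_pevolve_of_subset (ψ : M.PCfg →₀ ℂ) {S : Finset M.PCfg} (hS : ψ.support ⊆ S) :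
    ((sqNorm (M.pevolve ψ) : ℝ) : ℂ) =
      ∑ c₁ ∈ S, ∑ c₂ ∈ S, ψ c₁ * conj (ψ c₂) * M.pgram c₁ c₂ := by
  rw [sqNorm_pevolve]
  rw [Finset.sum_subset hS]
  · refine Finset.sum_congr rfl fun c₁ _ => Finset.sum_subset hS fun c₂ _ hc₂ => ?_
    rw [Finsupp.notMem_support_iff.1 hc₂, map_zero, mul_zero, zero_mul]
  · intro c₁ _ hc₁
    exact Finset.sum_eq_zero fun c₂ _ => by
      rw [Finsupp.notMem_support_iff.1 hc₁, zero_mul, zero_mul]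

/-- `‖ψ‖²` over any finite set containing the support (`sqNorm`, cast to `ℂ`). [folklore] -/
theorem coe_sqNorm_eq_sum_of_subset {α : Type*} (ψ : α →₀ ℂ) {S : Finset α} (hS : ψ.support ⊆ S) :
    ((sqNorm ψ : ℝ) : ℂ) = ∑ c ∈ S, ψ c * conj (ψ c) := by
  rw [coe_sqNorm_eq_sum]
  exact Finset.sum_subset hS fun c _ hc => by
    rw [Finsupp.notMem_support_iff.1 hc, zero_mul]

variable {M}

/-- For a BV-well-formed QTM the diagonal positioned Gram coefficients are `1`. [cite: BernsteinVazirani1997SICOMP, Thm. 5.3 (proof)] -/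
theorem PIsWellFormed.pgram_self (h : M.PIsWellFormed) (c : M.PCfg) : M.pgram c c = 1 := by
  classical
  have hψ : ((sqNorm (M.pevolve (Finsupp.single c 1)) : ℝ) : ℂ) =
      ((sqNorm (Finsupp.single c (1 : ℂ)) : ℝ) : ℂ) := by rw [h]
  have hS : (Finsupp.single c (1 : ℂ)).support ⊆ {c} := Finsupp.support_single_subset
  rw [M.sqNorm_pevolve_of_subset _ hS, coe_sqNorm_eq_sum_of_subset _ hS] at hψ
  simpa using hψ

/-- For a BV-well-formed QTM the off-diagonal positioned Gram coefficients vanish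
(polarisation with `|c₁⟩ + w |c₂⟩`, `w = 1, i`). [cite: BernsteinVazirani1997SICOMP, Thm. 5.3 (proof)] -/
theorem PIsWellFormed.pgram_eq_zero (h : M.PIsWellFormed) {c₁ c₂ : M.PCfg} (hne : c₁ ≠ c₂) :
    M.pgram c₁ c₂ = 0 := by
  classical
  have key : ∀ w : ℂ, conj w * M.pgram c₁ c₂ + w * M.pgram c₂ c₁ = 0 := by
    intro w
    set ψ : M.PCfg →₀ ℂ := Finsupp.single c₁ 1 + Finsupp.single c₂ w with hψdef
    have hS : ψ.support ⊆ {c₁, c₂} := by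
      refine Finsupp.support_add.trans (Finset.union_subset ?_ ?_)
      · exact Finsupp.support_single_subset.trans (by simp)
      · exact Finsupp.support_single_subset.trans (by simp)
    have h1 : ψ c₁ = 1 := by simp [hψdef, Ne.symm hne]
    have h2 : ψ c₂ = w := by simp [hψdef, hne]
    have hψ : ((sqNorm (M.pevolve ψ) : ℝ) : ℂ) = ((sqNorm ψ : ℝ) : ℂ) := by rw [h]
    rw [M.sqNorm_pevolve_of_subset _ hS, coe_sqNorm_eq_sum_of_subset _ hS,
      Finset.sum_insert (by simpa using hne), Finset.sum_singleton,
      Finset.sum_insert (by simpa using hne), Finset.sum_singleton,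
      Finset.sum_insert (by simpa using hne), Finset.sum_singleton,
      Finset.sum_insert (by simpa using hne), Finset.sum_singleton, h1, h2,
      h.pgram_self, h.pgram_self] at hψ
    simp only [map_one, one_mul, mul_one] at hψ
    linear_combination hψ
  have e1 := key 1
  have e2 := key Complex.I
  simp only [map_one, one_mul, Complex.conj_I] at e1 e2
  have hI : Complex.I ≠ 0 := Complex.I_ne_zero
  have : (2 : ℂ) * Complex.I * M.pgram c₁ c₂ = 0 := by linear_combination Complex.I * e1 - e2
  simpa [hI] using this

open Classical in
/-- **Gram form of BV well-formedness**: orthonormal columns of the time evolution matrix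
(BV proof of Thm. 5.3, first sentence). [cite: BernsteinVazirani1997SICOMP, Thm. 5.3 (proof)] -/
theorem pIsWellFormed_iff_pgram :
    M.PIsWellFormed ↔ ∀ c₁ c₂ : M.PCfg, M.pgram c₁ c₂ = if c₁ = c₂ then 1 else 0 := by
  refine ⟨fun h c₁ c₂ => ?_, M.pIsWellFormed_of_pgram⟩
  split_ifs with hc
  · subst hc; exact h.pgram_self c₁
  · exact h.pgram_eq_zero hc

variable (M)

/-- Test configurations for unit length and orthogonality in BV's model: state `p` scanning
`σ` on an otherwise blank tape, head at position `0` (equal positions exclude mixed-direction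
coincidences). [folklore] -/
def ptestCfg (p : M.Λ) (σ : M.Γ) : M.PCfg := ((⟨p, ⟨σ, default, default⟩⟩ : M.Cfg), 0)

/-- On positioned test configurations the Gram coefficient is `δ(p₁, σ₁) · δ(p₂, σ₂)`. [cite: BernsteinVazirani1997SICOMP, Thm. 5.3 (proof)] -/
theorem pgram_ptestCfg (p₁ : M.Λ) (σ₁ : M.Γ) (p₂ : M.Λ) (σ₂ : M.Γ) :
    M.pgram (M.ptestCfg p₁ σ₁) (M.ptestCfg p₂ σ₂) = M.updateInner p₁ σ₁ p₂ σ₂ := by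
  classical
  have h01 : M.pgramDir (M.ptestCfg p₁ σ₁) (M.ptestCfg p₂ σ₂) false true = 0 := by
    rw [pgramDir_ne]
    refine Finset.sum_eq_zero fun b₁ _ => Finset.sum_eq_zero fun b₂ _ => if_neg fun h => ?_
    have h' := h.2
    simp [ptestCfg] at h'
  have h10 : M.pgramDir (M.ptestCfg p₁ σ₁) (M.ptestCfg p₂ σ₂) true false = 0 := by
    rw [pgramDir_ne]
    refine Finset.sum_eq_zero fun b₁ _ => Finset.sum_eq_zero fun b₂ _ => if_neg fun h => ?_
    have h' := h.2
    simp [ptestCfg] at h'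
  rw [pgram_eq_sum_pgramDir, h01, h10, add_zero, zero_add,
    M.pgramDir_false_add_true (M.ptestCfg p₁ σ₁) (M.ptestCfg p₂ σ₂) ⟨rfl, rfl⟩ rfl]
  rfl

/-- First separability test configuration in BV's model: state `p₁` scanning `σ₁`, `# τ₂`
to the left, head at position `2` (BV proof of Thm. 5.3, third case). [cite: BernsteinVazirani1997SICOMP, Thm. 5.3 (proof)] -/
def psepCfg₁ (p₁ : M.Λ) (σ₁ τ₂ : M.Γ) : M.PCfg :=
  ((⟨p₁, ⟨σ₁, ListBlank.mk [default, τ₂], ListBlank.mk []⟩⟩ : M.Cfg), 2)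

/-- Second separability test configuration: state `p₂` scanning `σ₂`, `# τ₁` to the right, head
at position `0`, two cells to the left of `psepCfg₁`; writing `τ₁` and moving left from
`psepCfg₁` meets writing `τ₂` and moving right from `psepCfg₂`, and nothing else meets. [cite: BernsteinVazirani1997SICOMP, Thm. 5.3 (proof)] -/
def psepCfg₂ (p₂ : M.Λ) (σ₂ τ₁ : M.Γ) : M.PCfg :=
  ((⟨p₂, ⟨σ₂, ListBlank.mk [], ListBlank.mk [default, τ₁]⟩⟩ : M.Cfg), 0)

/-- On the positioned separability pair the Gram coefficient is the separability product
`δ(p₁, σ₁ | τ₁, L) · δ(p₂, σ₂ | τ₂, R)`. [cite: BernsteinVazirani1997SICOMP, Thm. 5.3 (proof)] -/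
theorem pgram_psepCfg (p₁ : M.Λ) (σ₁ τ₁ : M.Γ) (p₂ : M.Λ) (σ₂ τ₂ : M.Γ) :
    M.pgram (M.psepCfg₁ p₁ σ₁ τ₂) (M.psepCfg₂ p₂ σ₂ τ₁) =
      M.restrictedInner p₁ σ₁ τ₁ Dir.left p₂ σ₂ τ₂ Dir.right := by
  classical
  have hξ : ¬ (M.SameOffHead (M.psepCfg₁ p₁ σ₁ τ₂).1.tape (M.psepCfg₂ p₂ σ₂ τ₁).1.tape ∧
      (M.psepCfg₁ p₁ σ₁ τ₂).2 = (M.psepCfg₂ p₂ σ₂ τ₁).2) := fun h => by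
    have := h.2
    simp [psepCfg₁, psepCfg₂] at this
  have h10 : M.pgramDir (M.psepCfg₁ p₁ σ₁ τ₂) (M.psepCfg₂ p₂ σ₂ τ₁) true false = 0 := by
    rw [pgramDir_ne]
    refine Finset.sum_eq_zero fun b₁ _ => Finset.sum_eq_zero fun b₂ _ => if_neg fun h => ?_
    have h' := h.2
    simp [psepCfg₁, psepCfg₂] at h'
  have hcond : ∀ b₁ b₂ : M.Γ,
      (((M.psepCfg₁ p₁ σ₁ τ₂).1.tape.write b₁).move (dirOfBool false) =
          ((M.psepCfg₂ p₂ σ₂ τ₁).1.tape.write b₂).move (dirOfBool true) ∧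
        (M.psepCfg₁ p₁ σ₁ τ₂).2 + shiftOfBool false = (M.psepCfg₂ p₂ σ₂ τ₁).2 + shiftOfBool true) ↔
      τ₁ = b₁ ∧ τ₂ = b₂ := by
    intro b₁ b₂
    simp only [psepCfg₁, psepCfg₂, Tape.write_mk, dirOfBool_false, dirOfBool_true,
      shiftOfBool_false, shiftOfBool_true, tape_move_left_mk, tape_move_right_mk,
      ListBlank.cons_mk, ListBlank.tail_mk, ListBlank.head_mk, List.tail_cons, List.headI_cons,
      Tape.mk.injEq, true_and, listBlank_mk_cons_inj]
    constructor
    · rintro ⟨⟨h1, h2⟩, -⟩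
      exact ⟨h2.symm, h1⟩
    · rintro ⟨rfl, rfl⟩
      exact ⟨⟨rfl, rfl⟩, by norm_num⟩
  have h01 : M.pgramDir (M.psepCfg₁ p₁ σ₁ τ₂) (M.psepCfg₂ p₂ σ₂ τ₁) false true =
      M.restrictedInner p₁ σ₁ τ₁ Dir.left p₂ σ₂ τ₂ Dir.right := by
    rw [pgramDir_ne]
    simp_rw [hcond, sum_sum_ite_eq_and, Finset.sum_ite_eq, Finset.mem_univ, if_true]
    rfl
  rw [pgram_eq_sum_pgramDir, h01, h10, zero_add, pgramDir_same, pgramDir_same, if_neg hξ,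
    if_neg hξ, zero_add, add_zero]

variable {M}

/-- **Bernstein–Vazirani 1997, Theorem 5.3, necessity (p. 1434), in BV's model**: a
BV-well-formed QTM satisfies unit length, orthogonality and separability. Every tape alphabet
(positions, not marker symbols, separate the test configurations). [cite: BernsteinVazirani1997SICOMP, Thm. 5.3] -/
theorem PIsWellFormed.isLocallyWellFormed (h : M.PIsWellFormed) : M.IsLocallyWellFormed := by
  refine ⟨fun p σ => ?_, fun p₁ σ₁ p₂ σ₂ hne => ?_, fun p₁ σ₁ τ₁ p₂ σ₂ τ₂ => ?_⟩
  · have h1 := h.pgram_self (M.ptestCfg p σ)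
    rw [M.pgram_ptestCfg, updateInner_self] at h1
    exact_mod_cast h1
  · have hc : M.ptestCfg p₁ σ₁ ≠ M.ptestCfg p₂ σ₂ := by
      intro e
      simp only [ptestCfg, Prod.mk.injEq, Cfg.mk.injEq, Tape.mk.injEq, and_true] at e
      exact hne (by rw [e.1, e.2])
    rw [← M.pgram_ptestCfg, h.pgram_eq_zero hc]
  · have hc : M.psepCfg₁ p₁ σ₁ τ₂ ≠ M.psepCfg₂ p₂ σ₂ τ₁ := by
      intro e
      have := congrArg Prod.snd e
      simp [psepCfg₁, psepCfg₂] at this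
    rw [← M.pgram_psepCfg, h.pgram_eq_zero hc]

/-- **Bernstein–Vazirani 1997, Theorem 5.3 (p. 1434), verbatim in their model**: a QTM is well
formed (its time evolution on positioned configurations preserves length, Def. 3.3) iff its
local transition function satisfies unit length, orthogonality and separability. [cite: BernsteinVazirani1997SICOMP, Thm. 5.3] -/
theorem pIsWellFormed_iff_isLocallyWellFormed : M.PIsWellFormed ↔ M.IsLocallyWellFormed :=
  ⟨PIsWellFormed.isLocallyWellFormed, IsLocallyWellFormed.pIsWellFormed⟩

end QTM

end Literature.Computability.Cryptography

end
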